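import Summits.RiemannHypothesis.RiemannHypothesis.Theorems.SignConeExactConeRigidityDuality
import Summits.RiemannHypothesis.RiemannHypothesis.Theorems.SignConeSignConeUpTo210Reduction
import Literature.NumberTheory.LFunctions.WeilCriterionProofs
import HarnessLib

/-!
# Route SignCone, item `ExactConeRigidity` (stmt-RiemannHypothesis-16306): compactness of the
exact cones, and the reduction of the item to weight rigidity `K = {Λ}`

The 2001 exact chain for `ExactConeRigidity` (exact sign-cone inequality at every cutoff ⇒ RH)
has four steps: duality `K_a ≠ ∅` at each cutoff, compactness `∩_a K_a ≠ ∅`, rigidity `K = {Λ}`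
(W-COMP + W-SRPP), Weil's criterion. Duality is `signCone_conicDuality`
(`SignConeExactConeRigidityDuality.lean`); Weil's criterion is the tree's `weil_criterion_holds`.
This file does COMPACTNESS and assembles the chain modulo RIGIDITY:

* `re_weightSum_eq_sum` — for a window test `g` the weighted node sum
  `Σ' c(n) n^{-1/2}(G(log n) + G(−log n))` is a finite real sum `Σ_{n<N} c(n)/√n · 2 Re G(log n)`.
* `weight_le_of_feasible` — a-priori bound on the coordinates of feasible weights: testing the
  exact fake Weil form against a bump `φ` with `Re(φ ⋆ φ̃) ≥ 0`, `Re(φ ⋆ φ̃)(log n) > 0` gives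
  `c n ≤ √n Re W_ar(φ ⋆ φ̃) / (2 Re (φ ⋆ φ̃)(log n))`.
* `exists_weight_allCutoffs` — `(∀ a, ∃ c_a feasible at a) → ∃ c feasible at every a`
  (Tychonoff on `Π_n [0, B_n]` and Cantor's intersection theorem for the closed feasibility
  conditions; archive 2001: "`K_a` compact, decreasing in `a`").
* `exactSignCone_of_riemannHypothesis` — conversely RH implies the hypothesis of the item (the
  exact sign-cone inequality at every cutoff; `signConeAt_of_weilPositivityOn` of
  `SignConeSignConeUpTo210Reduction.lean` with `WeilPositivityOn.of_riemannHypothesis`), so that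
  hypothesis is RH-strength exactly.
* `ExactConeRigidity_of_weightRigidity` — the route item `ExactConeRigidity` follows from the
  single remaining statement (R): every nonnegative weight `c` (`c 1 = 0`) whose exact fake Weil
  form `W_ar − P_c` is nonnegative on all Weil tests is von Mangoldt's `Λ`
  (archive 2001 `rh-w-composite-vanishing` Thm 1.1 (W-COMP) with `rh-w-signed-rigidity` (W-SRPP);
  not formalised — their analytic inputs (resonator/type inequality, PNT for `c`) are open in the
  tree). With (R), `Λ ∈ K` is `WeilPositivity`, and `weil_criterion_holds` gives RH.

Vocabulary: Literature `IsWeilTest`, `weilConv`, `weilReflect`, `weilPolarTerm`, `weilArchTerm`,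
`weilPrimeTerm`, `weilQuadratic`, `WeilPositivity` (`Literature.NumberTheory.LFunctions.WeilExplicit`),
definitionally the route's Mathlib-primitive forms (route file, CONE NOTE).
-/

noncomputable section

open Complex Filter Set MeasureTheory
open scoped Real Topology ComplexConjugate ContDiff ArithmeticFunction.vonMangoldt

namespace Summit.RiemannHypothesis.RiemannHypothesis.Theorems.SignConeExactConeRigidity

open Literature.NumberTheory.LFunctions

variable {g : ℝ → ℂ} {a : ℝ}

/-! ## Node bookkeeping -/

/-- For `N = ⌊e^{2a}⌋ + 1` every `n ≥ N` has `2a ≤ log n` (indeed `<`). -/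
theorem two_mul_le_log_of_le {a : ℝ} {n : ℕ} (hn : ⌊Real.exp (2 * a)⌋₊ + 1 ≤ n) :
    2 * a ≤ Real.log n := by
  have h1 : Real.exp (2 * a) < n := by
    have := Nat.lt_of_floor_lt (lt_of_lt_of_le (Nat.lt_succ_self _) hn)
    exact_mod_cast this
  have hn0 : (0 : ℝ) < n := (Real.exp_pos _).trans h1
  rw [← Real.exp_le_exp, Real.exp_log hn0]
  exact h1.le

/-- The weighted node sum `Σ' c(n) n^{-1/2} (G(log n) + G(-log n))` of a window test `g`
(`G = g ⋆ g̃`) has real part the finite real sum `Σ_{n < N} c(n)/√n · 2 Re G(log n)` as soon as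
`2a ≤ log n` for all `n ≥ N`. -/
theorem re_weightSum_eq_sum (c : ℕ → ℝ) (hg : IsWeilTest g) (hsupp : tsupport g ⊆ Icc (-a) a)
    {N : ℕ} (hN : ∀ n : ℕ, N ≤ n → 2 * a ≤ Real.log n) :
    (∑' n : ℕ, ((c n : ℝ) : ℂ) / (Real.sqrt n : ℂ) *
        (weilConv g (weilReflect g) (Real.log n) + weilConv g (weilReflect g) (-Real.log n))).re =
      ∑ n ∈ Finset.range N, c n / Real.sqrt n * (2 * (weilConv g (weilReflect g) (Real.log n)).re) := by
  have hzero : ∀ n : ℕ, N ≤ n → weilConv g (weilReflect g) (Real.log n) = 0 := fun n hn ↦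
    weilConv_weilReflect_eq_zero_of_le_abs hg hsupp ((hN n hn).trans (le_abs_self _))
  have hzero' : ∀ n : ℕ, N ≤ n → weilConv g (weilReflect g) (-Real.log n) = 0 := fun n hn ↦
    weilConv_weilReflect_eq_zero_of_le_abs hg hsupp (by rw [abs_neg]; exact (hN n hn).trans (le_abs_self _))
  rw [tsum_eq_sum (s := Finset.range N) (fun n hn ↦ by
    rw [Finset.mem_range, not_lt] at hn
    rw [hzero n hn, hzero' n hn, add_zero, mul_zero]), Complex.re_sum]
  refine Finset.sum_congr rfl fun n _ ↦ ?_
  rw [← Complex.ofReal_div, Complex.re_ofReal_mul, Complex.add_re, weilConv_weilReflect_neg_re]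
  ring

/-! ## A-priori bound on the weights of the exact cone -/

/-- **Coordinate bound.** Let `φ` be a Weil test with `tsupport φ ⊆ [-r, r]` whose
autocorrelation `Φ = φ ⋆ φ̃` has `Re Φ ≥ 0` everywhere and `Re Φ(log n) > 0` (`n ≥ 1`). If a
nonnegative weight `c` is feasible at a cutoff `A ≥ r`, i.e.
`0 ≤ Re [W_ar(G) − Σ' c(m) m^{-1/2}(G(log m) + G(−log m))]` for all Weil tests of the window
`[-A, A]`, then `c n ≤ √n · Re W_ar(Φ) / (2 Re Φ(log n))`. -/
theorem weight_le_of_feasible {c : ℕ → ℝ} (hc : ∀ n, 0 ≤ c n) {A r : ℝ} (hrA : r ≤ A)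
    (hfeas : ∀ g : ℝ → ℂ, IsWeilTest g → tsupport g ⊆ Icc (-A) A →
      0 ≤ (weilPolarTerm (weilConv g (weilReflect g)) + weilArchTerm (weilConv g (weilReflect g)) -
        ∑' m : ℕ, ((c m : ℝ) : ℂ) / (Real.sqrt m : ℂ) *
          (weilConv g (weilReflect g) (Real.log m) + weilConv g (weilReflect g) (-Real.log m))).re)
    {φ : ℝ → ℂ} (hφ : IsWeilTest φ) (hφsupp : tsupport φ ⊆ Icc (-r) r)
    (hφnn : ∀ t, 0 ≤ (weilConv φ (weilReflect φ) t).re)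
    {n : ℕ} (hn : 1 ≤ n) (hφn : 0 < (weilConv φ (weilReflect φ) (Real.log n)).re) :
    c n ≤ Real.sqrt n *
      (weilPolarTerm (weilConv φ (weilReflect φ)) + weilArchTerm (weilConv φ (weilReflect φ))).re /
        (2 * (weilConv φ (weilReflect φ) (Real.log n)).re) := by
  set Φ := weilConv φ (weilReflect φ) with hΦ
  have hsuppA : tsupport φ ⊆ Icc (-A) A := hφsupp.trans (Icc_subset_Icc (by linarith) hrA)
  -- a common `N` beyond the window `A` and beyond `n`
  set N : ℕ := max (⌊Real.exp (2 * A)⌋₊ + 1) (n + 1) with hN_def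
  have hN : ∀ m : ℕ, N ≤ m → 2 * A ≤ Real.log m := fun m hm ↦
    two_mul_le_log_of_le ((le_max_left _ _).trans hm)
  have h := hfeas φ hφ hsuppA
  rw [Complex.sub_re, re_weightSum_eq_sum c hφ hsuppA hN, sub_nonneg] at h
  have hnN : n ∈ Finset.range N := Finset.mem_range.2 ((Nat.lt_succ_self n).trans_le (le_max_right _ _))
  have hsingle : c n / Real.sqrt n * (2 * (Φ (Real.log n)).re) ≤
      ∑ m ∈ Finset.range N, c m / Real.sqrt m * (2 * (Φ (Real.log m)).re) :=
    Finset.single_le_sum (f := fun m ↦ c m / Real.sqrt m * (2 * (Φ (Real.log m)).re))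
      (fun m _ ↦ mul_nonneg (div_nonneg (hc m) (Real.sqrt_nonneg _))
        (mul_nonneg zero_le_two (hφnn _))) hnN
  have hsq : 0 < Real.sqrt n := Real.sqrt_pos.2 (by exact_mod_cast hn)
  have hkey : c n / Real.sqrt n * (2 * (Φ (Real.log n)).re) ≤
      (weilPolarTerm Φ + weilArchTerm Φ).re := hsingle.trans h
  rw [le_div_iff₀ (by positivity)]
  calc c n * (2 * (Φ (Real.log n)).re)
      = Real.sqrt n * (c n / Real.sqrt n * (2 * (Φ (Real.log n)).re)) := by
        field_simp
    _ ≤ Real.sqrt n * (weilPolarTerm Φ + weilArchTerm Φ).re :=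
        mul_le_mul_of_nonneg_left hkey hsq.le

/-! ## Compactness: one weight for all cutoffs -/

/-- **Compactness of the exact cones** (archive 2001: `K_a` compact convex, decreasing in `a`,
hence `∩_a K_a ≠ ∅`). If at every cutoff `a > 0` some nonnegative weight `c_a` (`c_a 1 = 0`) has
exact fake Weil form `Re [W_ar(g ⋆ g̃) − Σ_n c_a(n) n^{-1/2}((g ⋆ g̃)(log n) + (g ⋆ g̃)(−log n))] ≥ 0`
on all Weil tests `g` supported in `[-a, a]`, then ONE nonnegative weight `c` (`c 1 = 0`) does so
at every cutoff simultaneously. Proof: the coordinates `n ≥ 2` of feasible weights are bounded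
a priori (`weight_le_of_feasible` with the bump of `exists_slater_bump` at radius
`log n / 2 + 1/4`), the feasibility conditions are closed in the product topology of `ℕ → ℝ`
(finite node sums, `re_weightSum_eq_sum`), so the sets `E_m` of weights in `Π_n [0, B_n]`
feasible at the cutoffs `1, …, m + 1` form a decreasing sequence of nonempty compact sets
(Tychonoff, `isCompact_univ_pi`), whose intersection is nonempty (Cantor). -/
theorem exists_weight_allCutoffs
    (hK : ∀ a : ℝ, 0 < a → ∃ c : ℕ → ℝ, (∀ n, 0 ≤ c n) ∧ c 1 = 0 ∧
      ∀ g : ℝ → ℂ, IsWeilTest g → tsupport g ⊆ Icc (-a) a →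
        0 ≤ (weilPolarTerm (weilConv g (weilReflect g)) +
          weilArchTerm (weilConv g (weilReflect g)) -
          ∑' n : ℕ, ((c n : ℝ) : ℂ) / (Real.sqrt n : ℂ) *
            (weilConv g (weilReflect g) (Real.log n) +
              weilConv g (weilReflect g) (-Real.log n))).re) :
    ∃ c : ℕ → ℝ, (∀ n, 0 ≤ c n) ∧ c 1 = 0 ∧ ∀ a : ℝ, 0 < a →
      ∀ g : ℝ → ℂ, IsWeilTest g → tsupport g ⊆ Icc (-a) a →
        0 ≤ (weilPolarTerm (weilConv g (weilReflect g)) +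
          weilArchTerm (weilConv g (weilReflect g)) -
          ∑' n : ℕ, ((c n : ℝ) : ℂ) / (Real.sqrt n : ℂ) *
            (weilConv g (weilReflect g) (Real.log n) +
              weilConv g (weilReflect g) (-Real.log n))).re := by
  classical
  -- bumps and a-priori bounds
  have hrad : ∀ n : ℕ, 0 < Real.log n / 2 + 1 / 4 := fun n ↦ by
    have := Real.log_natCast_nonneg n
    positivity
  choose φ hφ hφsupp hφpos using fun n : ℕ ↦ exists_slater_bump (hrad n)
  have hφnn : ∀ (n : ℕ) (t : ℝ), 0 ≤ (weilConv (φ n) (weilReflect (φ n)) t).re := by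
    intro n t
    by_cases ht : |t| < 2 * (Real.log n / 2 + 1 / 4)
    · exact (hφpos n t ht).le
    · rw [weilConv_weilReflect_eq_zero_of_le_abs (hφ n) (hφsupp n) (not_lt.1 ht), Complex.zero_re]
  have hφat : ∀ n : ℕ, 0 < (weilConv (φ n) (weilReflect (φ n)) (Real.log n)).re := fun n ↦ by
    refine hφpos n _ ?_
    rw [abs_of_nonneg (Real.log_natCast_nonneg n)]
    linarith [Real.log_natCast_nonneg n]
  set B : ℕ → ℝ := fun n ↦ max 0 (Real.sqrt n *
    (weilPolarTerm (weilConv (φ n) (weilReflect (φ n))) +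
      weilArchTerm (weilConv (φ n) (weilReflect (φ n)))).re /
      (2 * (weilConv (φ n) (weilReflect (φ n)) (Real.log n)).re)) with hB_def
  have hB0 : ∀ n, 0 ≤ B n := fun n ↦ le_max_left _ _
  -- node ranges per cutoff `j + 1`
  set Nf : ℕ → ℕ := fun j ↦ ⌊Real.exp (2 * ((j : ℝ) + 1))⌋₊ + 1 with hNf_def
  have hNf : ∀ (j n : ℕ), Nf j ≤ n → 2 * ((j : ℝ) + 1) ≤ Real.log n := fun j n hn ↦
    two_mul_le_log_of_le hn
  -- feasibility at cutoff `j + 1`, finite-sum form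
  set Feas : ℕ → (ℕ → ℝ) → Prop := fun j c ↦ ∀ g : ℝ → ℂ, IsWeilTest g →
    tsupport g ⊆ Icc (-((j : ℝ) + 1)) ((j : ℝ) + 1) →
      ∑ n ∈ Finset.range (Nf j), c n / Real.sqrt n *
        (2 * (weilConv g (weilReflect g) (Real.log n)).re) ≤
      (weilPolarTerm (weilConv g (weilReflect g)) + weilArchTerm (weilConv g (weilReflect g))).re
    with hFeas_def
  -- the compact box and the sets `E m`
  set Box : Set (ℕ → ℝ) := Set.pi Set.univ fun n ↦ Icc 0 (B n) with hBox_def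
  have hBox : IsCompact Box := isCompact_univ_pi fun n ↦ isCompact_Icc
  set E : ℕ → Set (ℕ → ℝ) := fun m ↦
    {c | c ∈ Box ∧ c 1 = 0 ∧ ∀ j, j ≤ m → Feas j c} with hE_def
  -- closedness
  have hFeas_closed : ∀ j, IsClosed {c : ℕ → ℝ | Feas j c} := by
    intro j
    have hset : {c : ℕ → ℝ | Feas j c} = ⋂ (g : ℝ → ℂ) (_ : IsWeilTest g)
        (_ : tsupport g ⊆ Icc (-((j : ℝ) + 1)) ((j : ℝ) + 1)),
        {c : ℕ → ℝ | ∑ n ∈ Finset.range (Nf j), c n / Real.sqrt n *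
          (2 * (weilConv g (weilReflect g) (Real.log n)).re) ≤
          (weilPolarTerm (weilConv g (weilReflect g)) +
            weilArchTerm (weilConv g (weilReflect g))).re} := by
      ext c
      simp only [hFeas_def, Set.mem_setOf_eq, Set.mem_iInter]
    rw [hset]
    refine isClosed_iInter fun g ↦ isClosed_iInter fun _ ↦ isClosed_iInter fun _ ↦ ?_
    refine isClosed_le ?_ continuous_const
    refine continuous_finsetSum _ fun n _ ↦ ?_
    exact ((continuous_apply n).div_const _).mul continuous_const
  have hE_closed : ∀ m, IsClosed (E m) := by
    intro m
    have hset : E m = (Box ∩ {c : ℕ → ℝ | c 1 = 0}) ∩ ⋂ (j : ℕ) (_ : j ≤ m), {c | Feas j c} := by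
      ext c
      simp only [hE_def, Set.mem_setOf_eq, Set.mem_inter_iff, Set.mem_iInter, and_assoc]
    rw [hset]
    refine (hBox.isClosed.inter (isClosed_eq (continuous_apply 1) continuous_const)).inter ?_
    exact isClosed_iInter fun j ↦ isClosed_iInter fun _ ↦ hFeas_closed j
  have hE_anti : ∀ m, E (m + 1) ⊆ E m := fun m c hc ↦
    ⟨hc.1, hc.2.1, fun j hj ↦ hc.2.2 j (hj.trans (Nat.le_succ m))⟩
  have hE_sub : ∀ m, E m ⊆ Box := fun m c hc ↦ hc.1
  -- nonemptiness
  have hE_ne : ∀ m, (E m).Nonempty := by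
    intro m
    have hA : (0 : ℝ) < (m : ℝ) + 2 := by positivity
    obtain ⟨c, hc0, hc1, hcf⟩ := hK _ hA
    -- truncate to the nodes `2 ≤ n`, `log n < 2(m+1)`
    refine ⟨fun n ↦ if 2 ≤ n ∧ Real.log n < 2 * ((m : ℝ) + 1) then c n else 0, ?_, ?_, ?_⟩
    · -- in the box
      simp only [hBox_def, Set.mem_pi, Set.mem_univ, true_implies, mem_Icc]
      intro n
      split_ifs with h
      · refine ⟨hc0 n, le_max_of_le_right ?_⟩
        have hr : Real.log n / 2 + 1 / 4 ≤ (m : ℝ) + 2 := by linarith [h.2]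
        exact weight_le_of_feasible hc0 hr hcf (hφ n) (hφsupp n) (hφnn n)
          (by omega) (hφat n)
      · exact ⟨le_rfl, hB0 n⟩
    · simp
    · intro j hj g hg hsupp
      have hjm : (j : ℝ) + 1 ≤ (m : ℝ) + 2 := by
        have : (j : ℝ) ≤ m := by exact_mod_cast hj
        linarith
      have hsuppA : tsupport g ⊆ Icc (-((m : ℝ) + 2)) ((m : ℝ) + 2) :=
        hsupp.trans (Icc_subset_Icc (by linarith) hjm)
      have h := hcf g hg hsuppA
      rw [Complex.sub_re, re_weightSum_eq_sum c hg hsupp (hNf j), sub_nonneg] at h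
      refine le_trans (le_of_eq (Finset.sum_congr rfl fun n _ ↦ ?_)) h
      dsimp only
      by_cases hcond : 2 ≤ n ∧ Real.log n < 2 * ((m : ℝ) + 1)
      · rw [if_pos hcond]
      · rw [if_neg hcond]
        rcases not_and_or.1 hcond with h2 | hlog
        · -- `n = 0` (where `x / √0 = 0`) or `n = 1` (where `c 1 = 0`)
          have hn2 : n < 2 := not_le.1 h2
          interval_cases n
          · simp
          · simp [hc1]
        · rw [weilConv_weilReflect_eq_zero_of_le_abs hg hsupp ?_]
          · simp
          · rw [abs_of_nonneg (Real.log_natCast_nonneg n)]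
            have : (j : ℝ) ≤ m := by exact_mod_cast hj
            linarith [not_lt.1 hlog]
  -- Cantor intersection
  have hE0 : IsCompact (E 0) := hBox.of_isClosed_subset (hE_closed 0) (hE_sub 0)
  obtain ⟨c, hc⟩ := IsCompact.nonempty_iInter_of_sequence_nonempty_isCompact_isClosed E hE_anti
    hE_ne hE0 hE_closed
  rw [Set.mem_iInter] at hc
  refine ⟨c, fun n ↦ ((hc 0).1 n (Set.mem_univ n)).1, (hc 0).2.1, fun a ha g hg hsupp ↦ ?_⟩
  -- feasibility at cutoff `a`: use `j = ⌈a⌉₊`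
  set j : ℕ := ⌈a⌉₊ with hj_def
  have hja : a ≤ (j : ℝ) + 1 := (Nat.le_ceil a).trans (le_add_of_nonneg_right zero_le_one)
  have hfe : Feas j c := (hc j).2.2 j le_rfl
  have hsuppj : tsupport g ⊆ Icc (-((j : ℝ) + 1)) ((j : ℝ) + 1) :=
    hsupp.trans (Icc_subset_Icc (by linarith) hja)
  have h := hfe g hg hsuppj
  rw [Complex.sub_re, re_weightSum_eq_sum c hg hsupp (fun n hn ↦ ?_), sub_nonneg]
  · exact h
  · exact le_trans (by linarith) (hNf j n hn)

/-! ## The item modulo weight rigidity -/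

/-- **`Λ ∈ K` is the Riemann hypothesis.** If von Mangoldt's weight is exact-feasible at every
cutoff — `0 ≤ Re [W_ar(g ⋆ g̃) − Σ_n Λ(n) n^{-1/2}((g ⋆ g̃)(log n) + (g ⋆ g̃)(−log n))]` for every
Weil test `g` of every window — then RH: the bracket is literally `weilFunctional (g ⋆ g̃) =
weilQuadratic g` (`weilPrimeTerm` is `P_Λ`), every test lives in some window, so this is
`WeilPositivity`, and `weil_criterion_holds` (Bombieri 2000 Thm 1, in the tree) concludes. -/
theorem riemannHypothesis_of_vonMangoldt_feasible
    (hΛ : ∀ a : ℝ, 0 < a → ∀ g : ℝ → ℂ, IsWeilTest g → tsupport g ⊆ Icc (-a) a →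
      0 ≤ (weilPolarTerm (weilConv g (weilReflect g)) +
        weilArchTerm (weilConv g (weilReflect g)) -
        ∑' n : ℕ, ((Λ n : ℝ) : ℂ) / (Real.sqrt n : ℂ) *
          (weilConv g (weilReflect g) (Real.log n) +
            weilConv g (weilReflect g) (-Real.log n))).re) :
    Summit.RiemannHypothesis := by
  have hWP : WeilPositivity := by
    intro g hg
    obtain ⟨R, hR⟩ := hg.2.isCompact.isBounded.subset_closedBall 0
    set a : ℝ := max R 1 with ha_def
    have ha : 0 < a := lt_of_lt_of_le zero_lt_one (le_max_right _ _)
    have hsupp : tsupport g ⊆ Icc (-a) a := by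
      refine hR.trans ?_
      rw [Real.closedBall_eq_Icc, zero_sub, zero_add]
      exact Icc_subset_Icc (neg_le_neg (le_max_left _ _)) (le_max_left _ _)
    have h := hΛ a ha g hg hsupp
    have hW : weilPolarTerm (weilConv g (weilReflect g)) +
        weilArchTerm (weilConv g (weilReflect g)) -
        ∑' n : ℕ, ((Λ n : ℝ) : ℂ) / (Real.sqrt n : ℂ) *
          (weilConv g (weilReflect g) (Real.log n) + weilConv g (weilReflect g) (-Real.log n)) =
        weilQuadratic g := by
      simp only [weilQuadratic, weilFunctional, weilPrimeTerm]
      ring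
    rwa [hW] at h
  exact weil_criterion_holds.2 hWP

/-- **`ExactConeRigidity` from weight rigidity** (the 2001 exact chain with "duality" and
"compactness" discharged in the tree, "rigidity `K = {Λ}`" (W-COMP + W-SRPP) taken as the
hypothesis `hR`, and "Weil's criterion" from `weil_criterion_holds`). Hypothesis `hR`: every
nonnegative weight `c` on `ℕ` with `c 1 = 0` whose exact fake Weil form
`Re [W_ar(g ⋆ g̃) − Σ_n c(n) n^{-1/2}((g ⋆ g̃)(log n) + (g ⋆ g̃)(−log n))]` is `≥ 0` on every Weil
test `g` of every window is von Mangoldt's `Λ`. Conclusion: the route item `ExactConeRigidity`.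
Proof: `signCone_conicDuality 0` at each cutoff gives `K_a ≠ ∅`, `exists_weight_allCutoffs`
gives `c ∈ K`, `hR` gives `c = Λ`, and `riemannHypothesis_of_vonMangoldt_feasible` concludes. -/
theorem ExactConeRigidity_of_weightRigidity
    (hR : ∀ c : ℕ → ℝ, (∀ n, 0 ≤ c n) → c 1 = 0 →
      (∀ a : ℝ, 0 < a → ∀ g : ℝ → ℂ, IsWeilTest g → tsupport g ⊆ Icc (-a) a →
        0 ≤ (weilPolarTerm (weilConv g (weilReflect g)) +
          weilArchTerm (weilConv g (weilReflect g)) -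
          ∑' n : ℕ, ((c n : ℝ) : ℂ) / (Real.sqrt n : ℂ) *
            (weilConv g (weilReflect g) (Real.log n) +
              weilConv g (weilReflect g) (-Real.log n))).re) →
      ∀ n, c n = Λ n) :
    Theses.SignCone.ExactConeRigidity := by
  intro hexact
  -- duality at each cutoff (`κ = 0`)
  have hK : ∀ a : ℝ, 0 < a → ∃ c : ℕ → ℝ, (∀ n, 0 ≤ c n) ∧ c 1 = 0 ∧
      ∀ g : ℝ → ℂ, IsWeilTest g → tsupport g ⊆ Icc (-a) a →
        0 ≤ (weilPolarTerm (weilConv g (weilReflect g)) +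
          weilArchTerm (weilConv g (weilReflect g)) -
          ∑' n : ℕ, ((c n : ℝ) : ℂ) / (Real.sqrt n : ℂ) *
            (weilConv g (weilReflect g) (Real.log n) +
              weilConv g (weilReflect g) (-Real.log n))).re := by
    intro a ha
    obtain ⟨c, hc0, hc1, hc⟩ := signCone_conicDuality 0 ha (fun k g hg hnodes ↦ by
      rw [zero_mul, neg_zero]
      exact hexact a ha k g hg hnodes)
    refine ⟨c, hc0, hc1, fun g hg hsupp ↦ ?_⟩
    have h := hc g hg hsupp
    rwa [zero_mul, neg_zero] at h
  -- compactness, rigidity, Weil's criterion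
  obtain ⟨c, hc0, hc1, hcK⟩ := exists_weight_allCutoffs hK
  have hcΛ : c = fun n ↦ (Λ n : ℝ) := funext (hR c hc0 hc1 hcK)
  subst hcΛ
  exact riemannHypothesis_of_vonMangoldt_feasible hcK

/-- **RH ⇒ the hypothesis of `ExactConeRigidity`**, in the item's own shape: under
`Summit.RiemannHypothesis` the exact (zero-slack) sign-cone inequality holds at every cutoff
(`signConeAt_of_weilPositivityOn` with `WeilPositivityOn.of_riemannHypothesis` and
`explicit_formula_holds`). So, granted the item, its hypothesis is EQUIVALENT to the Riemann
hypothesis (route file: "RH ⇒ X at once"). -/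
theorem exactSignCone_of_riemannHypothesis (hRH : Summit.RiemannHypothesis) (a : ℝ)
    (k : ℕ) (g : Fin k → ℝ → ℂ) (hg : ∀ i, IsWeilTest (g i) ∧ tsupport (g i) ⊆ Icc (-a) a)
    (hnodes : ∀ n : ℕ, 2 ≤ n → 0 ≤ (∑ i, weilConv (g i) (weilReflect (g i)) (Real.log n)).re) :
    0 ≤ (weilPolarTerm (fun t ↦ ∑ i, weilConv (g i) (weilReflect (g i)) t) +
      weilArchTerm (fun t ↦ ∑ i, weilConv (g i) (weilReflect (g i)) t)).re :=
  SignCone.signConeAt_of_weilPositivityOn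
    (WeilPositivityOn.of_riemannHypothesis explicit_formula_holds hRH a) hg hnodes

end Summit.RiemannHypothesis.RiemannHypothesis.Theorems.SignConeExactConeRigidity
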